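import Literature.RepresentationTheory.HeisenbergGroup.HeisenbergCentralCharacterReduction
import Literature.Analysis.SegalBargmann.StoneVonNeumannReal
import HarnessLib

/-!
# Existence of the irreducible unitary representation of a real Heisenberg group `Heisenberg B` with central character `𝐞 ∘ ℓ`: pull-back of the Schrödinger model along symplectic coordinates

Topic `RepresentationTheory/HeisenbergGroup`; namespace `Literature.RepresentationTheory.HeisenbergGroup`.

`HeisenbergCentralCharacterReduction` proves UNIQUENESS of the irreducible unitary representation of `Heisenberg B` (`B`
an `R`-bilinear law on a finite-dimensional real normed space `X`, `R` a commutative `ℝ`-algebra, centre acting by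
`𝐞 ∘ ℓ`) when the real commutator form `s = ℓ(B − Bᵀ)` is non-degenerate.  This file proves EXISTENCE, by transport
of the Schrödinger representation `rhoRep σ` on `L²(ℝ^σ)` (`StoneVonNeumannReal`): in symplectic coordinates
`e : X ≃ ℝⁿ × ℝⁿ` of `s` (`exists_symplecticCoords`) the laws `ℓ ∘ B` and `polar (dotPairing)` have the same
commutator form, so they differ by a SYMMETRIC form `D` and `(y, s) ↦ (e y, s − ½ D(y,y))` is a homomorphism
`Heisenberg (realForm B ℓ) →* HeisR (Fin n)` (`toHeisR`); composing with `toRealHeisenberg` and `rhoRep` gives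

* **`exists_irreducible_unitary_rep`**: for `ℓ` surjective and `ℓ(B − Bᵀ)` non-degenerate there exist `n` and a
  representation `ρ` of `Heisenberg B` on `L²(ℝⁿ)` which is unitary, has continuous orbit maps `y ↦ ρ(y,0)f`, central
  character `𝐞 ∘ ℓ`, and no closed invariant subspaces other than `⊥`, `⊤`.

Together with `exists_linearIsometryEquiv_of_irreducible_of_centralChar` this is the full local statement
"`ρ_ψ` exists and is unique up to isomorphism" of [GelbartRogawski1991, §3.1 p. 454 L19–21] at an archimedean place
(or block of places).  Everything is PROVED (Mathlib + tree); no cited statement is used as a hypothesis.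

## References

* [Folland1989] G. B. Folland, *Harmonic Analysis in Phase Space*, Princeton University Press, 1989, §1.3
  (1.22)–(1.25) (polarised vs. symmetric laws), §1.5 Theorem (1.50) (doi:10.1515/9781400882427).
* [GelbartRogawski1991] S. Gelbart, J. Rogawski, Invent. Math. 105 (1991), §3.1 p. 454 L17–21.
-/

noncomputable section

open MeasureTheory Complex
open scoped InnerProductSpace FourierTransform

namespace Literature.RepresentationTheory.HeisenbergGroup

open Literature.Analysis.SegalBargmann

variable {R : Type*} [CommRing R] [Algebra ℝ R]
variable {X : Type*} [NormedAddCommGroup X] [NormedSpace ℝ X] [FiniteDimensional ℝ X] [Module R X]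
  [IsScalarTower ℝ R X]

/-! ## 1. The homomorphism to the polarised model group in symplectic coordinates -/

section ToHeisR

variable {n : ℕ} (A : X →ₗ[ℝ] X →ₗ[ℝ] ℝ) (e : X ≃ₗ[ℝ] (Fin n → ℝ) × (Fin n → ℝ))

/-- The symmetric defect `D(y, y') = A(y, y') − p·q'` between a real law `A` and the polarised law in coordinates `e`.
[cite: Folland1989, §1.3 (1.22)–(1.25)] -/
def lawDefect : X →ₗ[ℝ] X →ₗ[ℝ] ℝ :=
  A - (polar (dotPairing (Fin n))).compl₁₂ e.toLinearMap e.toLinearMap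

omit [FiniteDimensional ℝ X] in
/-- unfolding. [cite: Folland1989, §1.3 (1.22)–(1.25)] -/
@[simp] theorem lawDefect_apply (y y' : X) : lawDefect A e y y' = A y y' - (e y).1 ⬝ᵥ (e y').2 := rfl

omit [FiniteDimensional ℝ X] in
/-- If `e` are symplectic coordinates for the commutator form of `A`, the defect is symmetric.
[cite: Folland1989, §1.3 (1.22)–(1.25)] -/
theorem lawDefect_comm (he : ∀ y y' : X, A y y' - A y' y = (e y).1 ⬝ᵥ (e y').2 - (e y').1 ⬝ᵥ (e y).2)
    (y y' : X) : lawDefect A e y y' = lawDefect A e y' y := by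
  rw [lawDefect_apply, lawDefect_apply]
  linarith [he y y']

omit [FiniteDimensional ℝ X] in
/-- **The homomorphism `(y, s) ↦ (e y, s − ½ D(y,y))`** from `Heisenberg A` to the polarised model group
`HeisR (Fin n)` in symplectic coordinates. [cite: Folland1989, §1.3 (1.22)–(1.25)] -/
def toHeisR (he : ∀ y y' : X, A y y' - A y' y = (e y).1 ⬝ᵥ (e y').2 - (e y').1 ⬝ᵥ (e y).2) :
    Heisenberg A →* HeisR (Fin n) where
  toFun h := ⟨e h.v, h.t - 2⁻¹ * lawDefect A e h.v h.v⟩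
  map_one' := by
    apply Heisenberg.ext
    · show e (1 : Heisenberg A).v = (1 : HeisR (Fin n)).v
      rw [Heisenberg.one_v, Heisenberg.one_v, map_zero]
    · show (1 : Heisenberg A).t - 2⁻¹ * lawDefect A e (1 : Heisenberg A).v (1 : Heisenberg A).v =
        (1 : HeisR (Fin n)).t
      rw [Heisenberg.one_t, Heisenberg.one_v, Heisenberg.one_t, map_zero]
      simp
  map_mul' a b := by
    apply Heisenberg.ext
    · show e (a * b).v = e a.v + e b.v
      rw [Heisenberg.mul_v, map_add]
    · show (a * b).t - 2⁻¹ * lawDefect A e (a * b).v (a * b).v =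
        (a.t - 2⁻¹ * lawDefect A e a.v a.v) + (b.t - 2⁻¹ * lawDefect A e b.v b.v) +
          polar (dotPairing (Fin n)) (e a.v) (e b.v)
      rw [Heisenberg.mul_t, Heisenberg.mul_v]
      simp only [map_add, LinearMap.add_apply, lawDefect_apply, polar_apply, dotPairing_apply]
      have h := lawDefect_comm A e he a.v b.v
      rw [lawDefect_apply, lawDefect_apply] at h
      linarith

omit [FiniteDimensional ℝ X] in
/-- unfolding. [cite: Folland1989, §1.3 (1.22)–(1.25)] -/
theorem toHeisR_apply (he : ∀ y y' : X, A y y' - A y' y = (e y).1 ⬝ᵥ (e y').2 - (e y').1 ⬝ᵥ (e y).2)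
    (h : Heisenberg A) : toHeisR A e he h = ⟨e h.v, h.t - 2⁻¹ * lawDefect A e h.v h.v⟩ := rfl

end ToHeisR

/-! ## 2. Existence -/

/-- **Existence of the irreducible unitary `𝐞 ∘ ℓ`-representation of `Heisenberg B`**: if `ℓ : R → ℝ` is onto and
the real commutator form `ℓ(B − Bᵀ)` is non-degenerate, there are `n` and a representation of `Heisenberg B` on
`L²(ℝⁿ)` (the Schrödinger model pulled back along symplectic coordinates) that is unitary, has continuous orbit maps,
central character `𝐞 ∘ ℓ`, and only the trivial closed invariant subspaces.
[cite: Folland1989, §1.5 Theorem (1.50); GelbartRogawski1991, §3.1 p. 454 L19–21] -/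
theorem exists_irreducible_unitary_rep (B : X →ₗ[R] X →ₗ[R] R) (ℓ : R →ₗ[ℝ] ℝ) (hℓ : Function.Surjective ℓ)
    (hs : (realForm B ℓ - (realForm B ℓ).flip).Nondegenerate) :
    ∃ (n : ℕ) (ρ : Representation ℂ (Heisenberg B) (Lp ℂ 2 (volume : Measure (Fin n → ℝ)))),
      (∀ (h : Heisenberg B) (f : Lp ℂ 2 (volume : Measure (Fin n → ℝ))), ‖ρ h f‖ = ‖f‖) ∧
      (∀ f : Lp ℂ 2 (volume : Measure (Fin n → ℝ)), Continuous fun y : X => ρ ⟨y, 0⟩ f) ∧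
      (∀ (t : R) (f : Lp ℂ 2 (volume : Measure (Fin n → ℝ))),
        ρ (Heisenberg.ofCenter B (Multiplicative.ofAdd t)) f = ((𝐞 (ℓ t) : Circle) : ℂ) • f) ∧
      ∀ K : Submodule ℂ (Lp ℂ 2 (volume : Measure (Fin n → ℝ))),
        IsClosed (K : Set (Lp ℂ 2 (volume : Measure (Fin n → ℝ)))) →
        (∀ (h : Heisenberg B), ∀ f ∈ K, ρ h f ∈ K) → K = ⊥ ∨ K = ⊤ := by
  obtain ⟨n, e, he⟩ := exists_symplecticCoords (realForm B ℓ) hs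
  have he' : ∀ y y' : X, realForm B ℓ y y' - realForm B ℓ y' y = (e y).1 ⬝ᵥ (e y').2 - (e y').1 ⬝ᵥ (e y).2 :=
    fun y y' => by simpa only [LinearMap.sub_apply, LinearMap.flip_apply] using he y y'
  set φ : Heisenberg B →* HeisR (Fin n) := (toHeisR (realForm B ℓ) e he').comp (toRealHeisenberg B ℓ) with hφ
  have hφapp : ∀ h : Heisenberg B, φ h = ⟨e h.v, ℓ h.t - 2⁻¹ * lawDefect (realForm B ℓ) e h.v h.v⟩ := fun h => rfl
  have hφsurj : Function.Surjective φ := by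
    intro g
    obtain ⟨t, ht⟩ := hℓ (g.t + 2⁻¹ * lawDefect (realForm B ℓ) e (e.symm g.v) (e.symm g.v))
    refine ⟨⟨e.symm g.v, t⟩, ?_⟩
    rw [hφapp]
    apply Heisenberg.ext
    · show e (e.symm g.v) = g.v
      rw [LinearEquiv.apply_symm_apply]
    · show ℓ t - 2⁻¹ * lawDefect (realForm B ℓ) e (e.symm g.v) (e.symm g.v) = g.t
      rw [ht]
      ring
  set ρ : Representation ℂ (Heisenberg B) (Lp ℂ 2 (volume : Measure (Fin n → ℝ))) := (rhoRep (Fin n)).comp φ with hρ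
  have hρapp : ∀ h f, ρ h f = rhoRep (Fin n) (φ h) f := fun h f => rfl
  refine ⟨n, ρ, fun h f => by rw [hρapp, norm_rhoRep_apply], fun f => ?_, fun t f => ?_, fun K hKc hK => ?_⟩
  · -- continuity of `y ↦ ρ (y, 0) f = 𝐞(-½D(y,y)) • rhoRep (e y, 0) f`
    have hD : Continuous fun y : X => lawDefect (realForm B ℓ) e y y := by
      have hL : Continuous fun y : X => LinearMap.toContinuousLinearMap (lawDefect (realForm B ℓ) e y) :=
        ((LinearMap.toContinuousLinearMap : (X →ₗ[ℝ] ℝ) ≃ₗ[ℝ] (X →L[ℝ] ℝ)).toLinearMap.comp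
          (lawDefect (realForm B ℓ) e)).continuous_of_finiteDimensional
      exact (isBoundedBilinearMap_apply (𝕜 := ℝ) (E := X) (F := ℝ)).continuous.comp (hL.prodMk continuous_id)
    have he_c : Continuous (e : X → (Fin n → ℝ) × (Fin n → ℝ)) := e.toLinearMap.continuous_of_finiteDimensional
    have h1 : ∀ y : X, ρ ⟨y, 0⟩ f = ((𝐞 (-(2⁻¹ * lawDefect (realForm B ℓ) e y y)) : Circle) : ℂ) •
        rhoRep (Fin n) ⟨e y, 0⟩ f := fun y => by
      rw [hρapp, hφapp, map_zero, zero_sub, apply_mk_eq_smul (rhoRep_center (Fin n))]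
    simp_rw [h1]
    have hc : Continuous fun y : X => ((𝐞 (-(2⁻¹ * lawDefect (realForm B ℓ) e y y)) : Circle) : ℂ) :=
      (continuous_subtype_val.comp Real.continuous_fourierChar).comp ((hD.const_mul _).neg)
    exact hc.smul ((continuous_rhoRep_apply (Fin n) f).comp he_c)
  · rw [hρapp]
    change rhoRep (Fin n) (φ ⟨0, t⟩) f = _
    rw [hφapp]
    simp only [map_zero, sub_zero, mul_zero]
    exact rhoRep_center (Fin n) (ℓ t) f
  · refine rhoRep_irreducible (Fin n) K hKc fun g f hf => ?_
    obtain ⟨h, rfl⟩ := hφsurj g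
    rw [← hρapp]
    exact hK h f hf

end Literature.RepresentationTheory.HeisenbergGroup

end
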